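import Summits.NavierStokesRegularity.NavierStokesRegularity.Theorems.TerminalTraceTypeITraceScarL3LoudDustUniformlyPerfect
import Mathlib.Topology.MetricSpace.Perfect
import Literature.Analysis.FluidPDE.LocalTypeI
import HarnessLib

/-!
# The LOUD dust is PERFECT and UNCOUNTABLE
# (item `TerminalTrace.TypeITraceScarL3`, stmt-NavierStokesRegularity-18385; ROUND-26 §3a (S2), continued)

Seat ns-typeII-p3 g10 (cell ns-regularity-ideate), `--supports stmt-NavierStokesRegularity-18385` (helper).
Continuation of `TerminalTraceTypeITraceScarL3LoudDustUniformlyPerfect`: under quiet-shell exclusion at ratio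
`A₀ > 1` for the class `(M, D₀, C)` (the hypothesis `hQA` of `stub_no_loudShellExtinctApex`, verbatim) the top
singular set `Σ₀(U) = {x | (0, x) backward singular}` of an extinct Type-I apex of that class meets every shell
`{R ≤ |y − x| ≤ A₀R}` around each of its points (`exists_topSingular_mem_shell_of_quietShellExclusion`).
Letting `R → 0`:

* `exists_topSingular_near_of_quietShellExclusion` — every top singular point is an ACCUMULATION point of
  `Σ₀` (another singular point within any `ε > 0`);
* `perfect_topSingularSet_of_quietShellExclusion` — `Σ₀` is a PERFECT set (closed, no isolated points;
  Mathlib's `Perfect`);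
* `not_countable_topSingularSet_of_quietShellExclusion` — if `U` is backward singular at the origin then
  `Σ₀` is UNCOUNTABLE (a non-empty perfect subset of the complete space `ℝ³` contains a copy of the Cantor
  space, `Perfect.exists_nat_bool_injection`), although `ℋ¹(Σ₀) = 0`
  (`hausdorffMeasure_topSingular_apex_eq_zero`): the «uncountable ℋ¹-null dust» of ROUND-26 §3a.

WHAT THIS IS NOT: not Stub QA / LOUD, not NS regularity — survivor geometry under the displayed hypothesis.
[folklore; Tao 2019 arXiv:1908.04958 §5 (shell of regularity); Kechris, Classical Descriptive Set Theory §6]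
-/

noncomputable section

set_option linter.dupNamespace false

namespace Summit.NavierStokesRegularity.NavierStokesRegularity.Theorems.TypeITraceScarL3

open MeasureTheory Set Function Filter Topology Metric
open Literature.Analysis.FluidPDE
open scoped NNReal ENNReal InnerProductSpace RealInnerProductSpace

/-- **Every top singular point of a loud survivor is an accumulation point of the top singular set**:
under quiet-shell exclusion at ratio `A₀` for the class, for every `x` with `(0, x)` backward singular and every
`ε > 0` there is `y ≠ x`, `‖y − x‖ < ε`, with `(0, y)` backward singular (the shell of radii
`ε/(2A₀) ≤ · ≤ ε/2` around `x` meets `Σ₀`). [folklore] -/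
theorem exists_topSingular_near_of_quietShellExclusion
    {M D₀ : ℝ≥0} {C A₀ : ℝ} (hA₀ : 1 < A₀)
    (hQA : ∀ (U : ℝ → EuclideanSpace ℝ (Fin 3) → EuclideanSpace ℝ (Fin 3))
      (P : ℝ → EuclideanSpace ℝ (Fin 3) → ℝ)
      (G : ℝ → EuclideanSpace ℝ (Fin 3) →
        EuclideanSpace ℝ (Fin 3) →L[ℝ] EuclideanSpace ℝ (Fin 3)),
      (∀ a : ℝ, 0 < a →
        IsSuitableWeakSolutionInBall a (0 : ℝ × EuclideanSpace ℝ (Fin 3)) U P) →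
      (∀ a : ℝ, 0 < a →
        HasWeakSpatialGradientOn
          (parabolicCylinderOpens a (0 : ℝ × EuclideanSpace ℝ (Fin 3))) U G) →
      (∀ a : ℝ, 0 < a →
        typeIBound (parabolicCylinder a (0 : ℝ × EuclideanSpace ℝ (Fin 3))) U P G ≤ M) →
      (∀ z₀ : ℝ × EuclideanSpace ℝ (Fin 3), z₀.1 ≤ 0 →
        ∀ r : ℝ, 0 < r → cknD r z₀ P ≤ D₀) →
      (∀ s : ℝ, s < 0 →
        ∀ᵐ y : EuclideanSpace ℝ (Fin 3), ‖U s y‖ ≤ C / Real.sqrt (-s)) →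
      (∀ φ : EuclideanSpace ℝ (Fin 3) → EuclideanSpace ℝ (Fin 3),
        ContDiff ℝ (⊤ : ℕ∞) φ →
        HasCompactSupport φ → ∀ ε : ℝ, 0 < ε →
        ∃ s₀ : ℝ, s₀ < 0 ∧ ∀ᵐ s ∂(volume.restrict (Ioo s₀ 0)), |∫ y, ⟪U s y, φ y⟫| ≤ ε) →
      (∃ δ : ℝ, 0 < δ ∧ ∃ R : ℝ, 0 < R ∧ ∃ K : ℝ,
        ∀ᵐ z ∂(volume.restrict
          (Ioo (-δ) 0 ×ˢ {y : EuclideanSpace ℝ (Fin 3) | R < ‖y‖ ∧ ‖y‖ < A₀ * R})),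
            ‖U z.1 z.2‖ ≤ K) →
      ¬ IsBackwardSingularPoint U (0 : ℝ × EuclideanSpace ℝ (Fin 3)))
    {U : ℝ → EuclideanSpace ℝ (Fin 3) → EuclideanSpace ℝ (Fin 3)}
    {P : ℝ → EuclideanSpace ℝ (Fin 3) → ℝ}
    {G : ℝ → EuclideanSpace ℝ (Fin 3) → EuclideanSpace ℝ (Fin 3) →L[ℝ] EuclideanSpace ℝ (Fin 3)}
    (hsw : ∀ a : ℝ, 0 < a →
      IsSuitableWeakSolutionInBall a (0 : ℝ × EuclideanSpace ℝ (Fin 3)) U P)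
    (hG : ∀ a : ℝ, 0 < a →
      HasWeakSpatialGradientOn
        (parabolicCylinderOpens a (0 : ℝ × EuclideanSpace ℝ (Fin 3))) U G)
    (hI : ∀ a : ℝ, 0 < a →
      typeIBound (parabolicCylinder a (0 : ℝ × EuclideanSpace ℝ (Fin 3))) U P G ≤ M)
    (hD : ∀ z₀ : ℝ × EuclideanSpace ℝ (Fin 3), z₀.1 ≤ 0 →
      ∀ r : ℝ, 0 < r → cknD r z₀ P ≤ D₀)
    (hrate : ∀ s : ℝ, s < 0 →
      ∀ᵐ y : EuclideanSpace ℝ (Fin 3), ‖U s y‖ ≤ C / Real.sqrt (-s))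
    (htop : ∀ φ : EuclideanSpace ℝ (Fin 3) → EuclideanSpace ℝ (Fin 3),
      ContDiff ℝ (⊤ : ℕ∞) φ →
      HasCompactSupport φ → ∀ ε : ℝ, 0 < ε →
      ∃ s₀ : ℝ, s₀ < 0 ∧ ∀ᵐ s ∂(volume.restrict (Ioo s₀ 0)), |∫ y, ⟪U s y, φ y⟫| ≤ ε)
    {x : EuclideanSpace ℝ (Fin 3)} (hx : IsBackwardSingularPoint U ((0 : ℝ), x))
    {ε : ℝ} (hε : 0 < ε) :
    ∃ y : EuclideanSpace ℝ (Fin 3), y ≠ x ∧ ‖y - x‖ < ε ∧ IsBackwardSingularPoint U ((0 : ℝ), y) := by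
  have hA₀pos : 0 < A₀ := zero_lt_one.trans hA₀
  have hRpos : 0 < ε / (2 * A₀) := by positivity
  obtain ⟨y, hy1, hy2, hy3⟩ := exists_topSingular_mem_shell_of_quietShellExclusion hA₀ hQA hsw hG hI hD
    hrate htop hx hRpos
  refine ⟨y, ?_, ?_, hy3⟩
  · intro hyx
    rw [hyx, sub_self, norm_zero] at hy1
    exact absurd hy1 (not_le.2 hRpos)
  · calc ‖y - x‖ ≤ A₀ * (ε / (2 * A₀)) := hy2
      _ = ε / 2 := by field_simp
      _ < ε := half_lt_self hε

/-- **The top singular set of a loud survivor is PERFECT** (closed — `isClosed_topSingularSet` — and without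
isolated points, by `exists_topSingular_near_of_quietShellExclusion`). [folklore] -/
theorem perfect_topSingularSet_of_quietShellExclusion
    {M D₀ : ℝ≥0} {C A₀ : ℝ} (hA₀ : 1 < A₀)
    (hQA : ∀ (U : ℝ → EuclideanSpace ℝ (Fin 3) → EuclideanSpace ℝ (Fin 3))
      (P : ℝ → EuclideanSpace ℝ (Fin 3) → ℝ)
      (G : ℝ → EuclideanSpace ℝ (Fin 3) →
        EuclideanSpace ℝ (Fin 3) →L[ℝ] EuclideanSpace ℝ (Fin 3)),
      (∀ a : ℝ, 0 < a →
        IsSuitableWeakSolutionInBall a (0 : ℝ × EuclideanSpace ℝ (Fin 3)) U P) →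
      (∀ a : ℝ, 0 < a →
        HasWeakSpatialGradientOn
          (parabolicCylinderOpens a (0 : ℝ × EuclideanSpace ℝ (Fin 3))) U G) →
      (∀ a : ℝ, 0 < a →
        typeIBound (parabolicCylinder a (0 : ℝ × EuclideanSpace ℝ (Fin 3))) U P G ≤ M) →
      (∀ z₀ : ℝ × EuclideanSpace ℝ (Fin 3), z₀.1 ≤ 0 →
        ∀ r : ℝ, 0 < r → cknD r z₀ P ≤ D₀) →
      (∀ s : ℝ, s < 0 →
        ∀ᵐ y : EuclideanSpace ℝ (Fin 3), ‖U s y‖ ≤ C / Real.sqrt (-s)) →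
      (∀ φ : EuclideanSpace ℝ (Fin 3) → EuclideanSpace ℝ (Fin 3),
        ContDiff ℝ (⊤ : ℕ∞) φ →
        HasCompactSupport φ → ∀ ε : ℝ, 0 < ε →
        ∃ s₀ : ℝ, s₀ < 0 ∧ ∀ᵐ s ∂(volume.restrict (Ioo s₀ 0)), |∫ y, ⟪U s y, φ y⟫| ≤ ε) →
      (∃ δ : ℝ, 0 < δ ∧ ∃ R : ℝ, 0 < R ∧ ∃ K : ℝ,
        ∀ᵐ z ∂(volume.restrict
          (Ioo (-δ) 0 ×ˢ {y : EuclideanSpace ℝ (Fin 3) | R < ‖y‖ ∧ ‖y‖ < A₀ * R})),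
            ‖U z.1 z.2‖ ≤ K) →
      ¬ IsBackwardSingularPoint U (0 : ℝ × EuclideanSpace ℝ (Fin 3)))
    {U : ℝ → EuclideanSpace ℝ (Fin 3) → EuclideanSpace ℝ (Fin 3)}
    {P : ℝ → EuclideanSpace ℝ (Fin 3) → ℝ}
    {G : ℝ → EuclideanSpace ℝ (Fin 3) → EuclideanSpace ℝ (Fin 3) →L[ℝ] EuclideanSpace ℝ (Fin 3)}
    (hsw : ∀ a : ℝ, 0 < a →
      IsSuitableWeakSolutionInBall a (0 : ℝ × EuclideanSpace ℝ (Fin 3)) U P)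
    (hG : ∀ a : ℝ, 0 < a →
      HasWeakSpatialGradientOn
        (parabolicCylinderOpens a (0 : ℝ × EuclideanSpace ℝ (Fin 3))) U G)
    (hI : ∀ a : ℝ, 0 < a →
      typeIBound (parabolicCylinder a (0 : ℝ × EuclideanSpace ℝ (Fin 3))) U P G ≤ M)
    (hD : ∀ z₀ : ℝ × EuclideanSpace ℝ (Fin 3), z₀.1 ≤ 0 →
      ∀ r : ℝ, 0 < r → cknD r z₀ P ≤ D₀)
    (hrate : ∀ s : ℝ, s < 0 →
      ∀ᵐ y : EuclideanSpace ℝ (Fin 3), ‖U s y‖ ≤ C / Real.sqrt (-s))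
    (htop : ∀ φ : EuclideanSpace ℝ (Fin 3) → EuclideanSpace ℝ (Fin 3),
      ContDiff ℝ (⊤ : ℕ∞) φ →
      HasCompactSupport φ → ∀ ε : ℝ, 0 < ε →
      ∃ s₀ : ℝ, s₀ < 0 ∧ ∀ᵐ s ∂(volume.restrict (Ioo s₀ 0)), |∫ y, ⟪U s y, φ y⟫| ≤ ε) :
    Perfect {x : EuclideanSpace ℝ (Fin 3) | IsBackwardSingularPoint U ((0 : ℝ), x)} := by
  refine ⟨isClosed_topSingularSet U, ?_⟩
  rw [preperfect_iff_nhds]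
  intro x hx V hV
  obtain ⟨ε, hε, hball⟩ := Metric.mem_nhds_iff.1 hV
  obtain ⟨y, hyx, hyε, hy⟩ := exists_topSingular_near_of_quietShellExclusion hA₀ hQA hsw hG hI hD hrate
    htop hx hε
  exact ⟨y, ⟨hball (mem_ball_iff_norm.2 hyε), hy⟩, hyx⟩

/-- **The top singular set of a backward-singular loud survivor is UNCOUNTABLE**: a non-empty perfect subset
of the complete metric space `ℝ³` receives a continuous injection of the Cantor space `ℕ → Bool`
(`Perfect.exists_nat_bool_injection`), whose cardinal `2^ℵ₀` exceeds `ℵ₀` (Cantor).  Together with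
`hausdorffMeasure_topSingular_apex_eq_zero` this is the «uncountable ℋ¹-null dust» of ROUND-26 §3a. [folklore] -/
theorem not_countable_topSingularSet_of_quietShellExclusion
    {M D₀ : ℝ≥0} {C A₀ : ℝ} (hA₀ : 1 < A₀)
    (hQA : ∀ (U : ℝ → EuclideanSpace ℝ (Fin 3) → EuclideanSpace ℝ (Fin 3))
      (P : ℝ → EuclideanSpace ℝ (Fin 3) → ℝ)
      (G : ℝ → EuclideanSpace ℝ (Fin 3) →
        EuclideanSpace ℝ (Fin 3) →L[ℝ] EuclideanSpace ℝ (Fin 3)),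
      (∀ a : ℝ, 0 < a →
        IsSuitableWeakSolutionInBall a (0 : ℝ × EuclideanSpace ℝ (Fin 3)) U P) →
      (∀ a : ℝ, 0 < a →
        HasWeakSpatialGradientOn
          (parabolicCylinderOpens a (0 : ℝ × EuclideanSpace ℝ (Fin 3))) U G) →
      (∀ a : ℝ, 0 < a →
        typeIBound (parabolicCylinder a (0 : ℝ × EuclideanSpace ℝ (Fin 3))) U P G ≤ M) →
      (∀ z₀ : ℝ × EuclideanSpace ℝ (Fin 3), z₀.1 ≤ 0 →
        ∀ r : ℝ, 0 < r → cknD r z₀ P ≤ D₀) →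
      (∀ s : ℝ, s < 0 →
        ∀ᵐ y : EuclideanSpace ℝ (Fin 3), ‖U s y‖ ≤ C / Real.sqrt (-s)) →
      (∀ φ : EuclideanSpace ℝ (Fin 3) → EuclideanSpace ℝ (Fin 3),
        ContDiff ℝ (⊤ : ℕ∞) φ →
        HasCompactSupport φ → ∀ ε : ℝ, 0 < ε →
        ∃ s₀ : ℝ, s₀ < 0 ∧ ∀ᵐ s ∂(volume.restrict (Ioo s₀ 0)), |∫ y, ⟪U s y, φ y⟫| ≤ ε) →
      (∃ δ : ℝ, 0 < δ ∧ ∃ R : ℝ, 0 < R ∧ ∃ K : ℝ,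
        ∀ᵐ z ∂(volume.restrict
          (Ioo (-δ) 0 ×ˢ {y : EuclideanSpace ℝ (Fin 3) | R < ‖y‖ ∧ ‖y‖ < A₀ * R})),
            ‖U z.1 z.2‖ ≤ K) →
      ¬ IsBackwardSingularPoint U (0 : ℝ × EuclideanSpace ℝ (Fin 3)))
    {U : ℝ → EuclideanSpace ℝ (Fin 3) → EuclideanSpace ℝ (Fin 3)}
    {P : ℝ → EuclideanSpace ℝ (Fin 3) → ℝ}
    {G : ℝ → EuclideanSpace ℝ (Fin 3) → EuclideanSpace ℝ (Fin 3) →L[ℝ] EuclideanSpace ℝ (Fin 3)}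
    (hsw : ∀ a : ℝ, 0 < a →
      IsSuitableWeakSolutionInBall a (0 : ℝ × EuclideanSpace ℝ (Fin 3)) U P)
    (hG : ∀ a : ℝ, 0 < a →
      HasWeakSpatialGradientOn
        (parabolicCylinderOpens a (0 : ℝ × EuclideanSpace ℝ (Fin 3))) U G)
    (hI : ∀ a : ℝ, 0 < a →
      typeIBound (parabolicCylinder a (0 : ℝ × EuclideanSpace ℝ (Fin 3))) U P G ≤ M)
    (hD : ∀ z₀ : ℝ × EuclideanSpace ℝ (Fin 3), z₀.1 ≤ 0 →
      ∀ r : ℝ, 0 < r → cknD r z₀ P ≤ D₀)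
    (hrate : ∀ s : ℝ, s < 0 →
      ∀ᵐ y : EuclideanSpace ℝ (Fin 3), ‖U s y‖ ≤ C / Real.sqrt (-s))
    (htop : ∀ φ : EuclideanSpace ℝ (Fin 3) → EuclideanSpace ℝ (Fin 3),
      ContDiff ℝ (⊤ : ℕ∞) φ →
      HasCompactSupport φ → ∀ ε : ℝ, 0 < ε →
      ∃ s₀ : ℝ, s₀ < 0 ∧ ∀ᵐ s ∂(volume.restrict (Ioo s₀ 0)), |∫ y, ⟪U s y, φ y⟫| ≤ ε)
    (hsing : IsBackwardSingularPoint U (0 : ℝ × EuclideanSpace ℝ (Fin 3))) :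
    ¬ ({x : EuclideanSpace ℝ (Fin 3) | IsBackwardSingularPoint U ((0 : ℝ), x)}).Countable := by
  intro hcount
  have hperf := perfect_topSingularSet_of_quietShellExclusion hA₀ hQA hsw hG hI hD hrate htop
  have hne : ({x : EuclideanSpace ℝ (Fin 3) | IsBackwardSingularPoint U ((0 : ℝ), x)}).Nonempty :=
    ⟨0, hsing⟩
  obtain ⟨f, hfrange, -, hfinj⟩ := hperf.exists_nat_bool_injection hne
  -- the Cantor space would be countable
  have hcnt : Countable (ℕ → Bool) := by
    have h1 : (f ⁻¹' {x : EuclideanSpace ℝ (Fin 3) | IsBackwardSingularPoint U ((0 : ℝ), x)}).Countable :=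
      hcount.preimage_of_injOn hfinj.injOn
    have h2 : f ⁻¹' {x : EuclideanSpace ℝ (Fin 3) | IsBackwardSingularPoint U ((0 : ℝ), x)} = univ :=
      eq_univ_of_forall fun a => hfrange (mem_range_self a)
    rw [h2] at h1
    exact Set.countable_univ_iff.1 h1
  have h1 : Cardinal.mk (ℕ → Bool) ≤ Cardinal.aleph0 := Cardinal.mk_le_aleph0_iff.2 hcnt
  have h2 : Cardinal.mk (ℕ → Bool) = 2 ^ Cardinal.aleph0 := by
    rw [Cardinal.mk_arrow]; simp
  rw [h2] at h1
  exact not_le_of_gt (Cardinal.cantor Cardinal.aleph0) h1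

end Summit.NavierStokesRegularity.NavierStokesRegularity.Theorems.TypeITraceScarL3

end
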